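import Literature.Geometry.ComplexHyperbolic.UnitBallLieAlgebraHCGenerators   -- ★ (b3-pre) p846552; brings ★ (a0)(a1)(a1′)(b0)(b1)
import HarnessLib

/-!
# `C_c^∞(𝔤)` is stable under Harish-Chandra's generators; `h ↦ φ_h(θ)` is linear and `φ_f` is smooth on the regular set; the sup-norm basis bound for jets
# (ROAD «A6-IV» brick (d2) FILE 1 «HC CLOSURE»; Warner II, proof of Thm. 8.4.3.1, the bookkeeping half)

Topic `Geometry/ComplexHyperbolic`; namespace `Literature.Geometry.ComplexHyperbolic.BallModel` (§4 generic: `Literature.Analysis.Calculus`).  THEOREMS ONLY (no `def`, no instance, no notation,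
no axiom, no named fact, no `sorry`).  Cell `pub/hodgecm-mathlib`, ENGINE T1 (crux H413 = `stmt-HodgeConjecture-24833`); ROAD A, design of record `DESIGN-A6-InHouse-v2-ArchitectureIV`
93542b84 (LEAD T11-4), owner word R-15.9 (the (d2) plan, FILE 1 of 3); author F0P3a-p05 (g15) (ROAD A owner), 2026-09-01.

THE MATHEMATICS (Harish-Chandra's bootstrap [WarnerHASSLG2, proof of Thm. 8.4.3.1] needs, besides the generator identities ★ (E1)(E2)(E3), three pieces of bookkeeping):
* §1 CLOSURE: the invariant operators `lieCentral = D(·)[i·1]`, `lieLaplacian = Σ_a w_a D²(·)[E_a,E_a]`, `lieCubic = Σ_{abc} (w_a w_b w_c κ_{abc}) D³(·)[E_a,E_b,E_c]` and the scalars map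
  `C_c^∞(M₃(ℂ); E)` to itself WITHOUT ENLARGING THE SUPPORT (`tsupport (Z h) ⊆ tsupport h`), so every word `Z` in them sends a test function carried by `‖X‖ ≤ R` to one carried by `‖X‖ ≤ R` —
  the crude bound (c3′) is then uniform over words.
* §2 LINEARITY: at a regular `θ` (`θ₀ ≠ θ₂`, `θ₁ ≠ θ₂`) the integrand `g ↦ h(Ad_g torusH θ)` is continuous with compact support (★ (a1′) `isCompact_setOf_conj_torusH_mem_tsupport`), hence integrable,
  so `h ↦ lieOrbital μ h (torusH θ)` and `h ↦ liePhi μ h θ` are additive and homogeneous.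
* §3 SMOOTHNESS ON THE REGULAR SET: `liePhi μ f = π • Φ_f` is `C^∞` at every `θ` off the two singular walls (★ (a1) `contDiffAt_lieOrbital_torusH`), in particular `ContDiffOn` the open set
  `{rootProduct ≠ 0}` on which (E2)(E3) hold — the locality domain for composing constant-coefficient operators (p09's `polyDeriv_mul_eqOn`).
* §4 THE SUP-NORM BASIS BOUND (generic): for a continuous multilinear map `A` on `(ι → ℝ)ⁿ` (sup norm), `‖A‖ ≤ Σ_{k : Fin n → ι} ‖A(e_{k₁}, …, e_{kₙ})‖` — so a jet `Dⁿφ(θ)` is bounded by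
  its `|ι|ⁿ` pure coordinate partials, which is how the harmonic decomposition (e) of the MONOMIALS `∂^α` controls `‖Dⁿφ_f‖`.
HONEST LABEL: HC_CM is proved only modulo the printed citations until rung 0 closes; elementary, pays nothing by itself.

## References
* [WarnerHASSLG2] G. Warner, *Harmonic Analysis on Semi-Simple Lie Groups II*, Grundlehren 189 (1972), §8.4.3, proof of Thm. 8.4.3.1; §8.4.1.
* [HarishChandra1957DiffOps] Harish-Chandra, *Differential operators on a semisimple Lie algebra*, Amer. J. Math. 79 (1957), §2 (invariant constant-coefficient operators preserve `C_c^∞`).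
* [Rudin1976] W. Rudin, *Principles of Mathematical Analysis*, 3rd ed. (1976), Thm. 9.21 (coordinates of multilinear maps).
-/

set_option autoImplicit false

noncomputable section

namespace Literature.Geometry.ComplexHyperbolic

namespace BallModel

open _root_.Complex _root_.Matrix _root_.MeasureTheory _root_.Set _root_.Filter _root_.Topology _root_.Function
open scoped Matrix.Norms.Operator ComplexConjugate ContDiff

variable {E : Type*} [NormedAddCommGroup E] [NormedSpace ℝ E]

/-! ## §1 Closure of `C_c^∞` under the generators, without enlarging the support -/

section Closure

/-- `X ↦ Dⁿf(X)[v]` is `C^∞` for `f ∈ C^∞` and a fixed direction tuple `v`. [cite: HarishChandra1957DiffOps, §2] -/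
theorem contDiff_iteratedFDeriv_apply_const {f : Matrix (Fin 3) (Fin 3) ℂ → E} (hf : ContDiff ℝ ∞ f) (n : ℕ) (v : Fin n → Matrix (Fin 3) (Fin 3) ℂ) :
    ContDiff ℝ ∞ fun X => iteratedFDeriv ℝ n f X v := by
  have h := (ContinuousMultilinearMap.apply ℝ (fun _ : Fin n => Matrix (Fin 3) (Fin 3) ℂ) E v).contDiff.comp
    (hf.iteratedFDeriv_right (i := n) (m := ∞) (by exact_mod_cast le_top))
  exact h

omit [NormedSpace ℝ E] in
/-- Off `tsupport f` every iterated derivative of `f` vanishes in every direction. [cite: HarishChandra1957DiffOps, §2] -/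
theorem iteratedFDeriv_apply_eq_zero_of_notMem_tsupport [NormedSpace ℝ E] {f : Matrix (Fin 3) (Fin 3) ℂ → E} {X : Matrix (Fin 3) (Fin 3) ℂ} (hX : X ∉ tsupport f) (n : ℕ)
    (v : Fin n → Matrix (Fin 3) (Fin 3) ℂ) : iteratedFDeriv ℝ n f X v = 0 := by
  have h : iteratedFDeriv ℝ n f X = 0 := notMem_support.1 fun h => hX (support_iteratedFDeriv_subset n h)
  rw [h]
  rfl

/-- `tsupport (X ↦ Dⁿf(X)[v]) ⊆ tsupport f`. [cite: HarishChandra1957DiffOps, §2] -/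
theorem tsupport_iteratedFDeriv_apply_const_subset (f : Matrix (Fin 3) (Fin 3) ℂ → E) (n : ℕ) (v : Fin n → Matrix (Fin 3) (Fin 3) ℂ) :
    tsupport (fun X => iteratedFDeriv ℝ n f X v) ⊆ tsupport f :=
  (tsupport_comp_subset (g := fun L : ContinuousMultilinearMap ℝ (fun _ : Fin n => Matrix (Fin 3) (Fin 3) ℂ) E => L v) rfl _).trans (tsupport_iteratedFDeriv_subset n)

/-- **`lieCentral` PRESERVES `C^∞`.** [cite: HarishChandra1957DiffOps, §2] -/
theorem contDiff_lieCentral {f : Matrix (Fin 3) (Fin 3) ℂ → E} (hf : ContDiff ℝ ∞ f) : ContDiff ℝ ∞ (lieCentral f) := by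
  have h : lieCentral f = fun X => fderiv ℝ f X (I • (1 : Matrix (Fin 3) (Fin 3) ℂ)) := funext fun X => lieCentral_def f X
  rw [h]
  exact (hf.fderiv_right (m := ∞) le_rfl).clm_apply contDiff_const

/-- `tsupport (lieCentral f) ⊆ tsupport f`. [cite: HarishChandra1957DiffOps, §2] -/
theorem tsupport_lieCentral_subset (f : Matrix (Fin 3) (Fin 3) ℂ → E) : tsupport (lieCentral f) ⊆ tsupport f := by
  have h : lieCentral f = fun X => fderiv ℝ f X (I • (1 : Matrix (Fin 3) (Fin 3) ℂ)) := funext fun X => lieCentral_def f X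
  rw [h]
  exact tsupport_fderiv_apply_subset ℝ _

/-- **`lieCentral` PRESERVES COMPACT SUPPORT.** [cite: HarishChandra1957DiffOps, §2] -/
theorem hasCompactSupport_lieCentral {f : Matrix (Fin 3) (Fin 3) ℂ → E} (hfc : HasCompactSupport f) : HasCompactSupport (lieCentral f) :=
  HasCompactSupport.of_support_subset_isCompact hfc ((subset_tsupport _).trans (tsupport_lieCentral_subset f))

/-- **`lieLaplacian` PRESERVES `C^∞`.** [cite: HarishChandra1957DiffOps, §2] -/
theorem contDiff_lieLaplacian {f : Matrix (Fin 3) (Fin 3) ℂ → E} (hf : ContDiff ℝ ∞ f) : ContDiff ℝ ∞ (lieLaplacian f) := by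
  have h : lieLaplacian f = fun X => ∑ a : Fin 9, lieWeight a • iteratedFDeriv ℝ 2 f X ![lieBasis a, lieBasis a] := funext fun X => lieLaplacian_def f X
  rw [h]
  exact ContDiff.sum fun a _ => (contDiff_iteratedFDeriv_apply_const hf 2 _).const_smul _

/-- `tsupport (lieLaplacian f) ⊆ tsupport f`. [cite: HarishChandra1957DiffOps, §2] -/
theorem tsupport_lieLaplacian_subset (f : Matrix (Fin 3) (Fin 3) ℂ → E) : tsupport (lieLaplacian f) ⊆ tsupport f := by
  refine closure_minimal (fun X hX => ?_) (isClosed_tsupport f)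
  by_contra hXt
  refine hX ?_
  rw [lieLaplacian_def]
  exact Finset.sum_eq_zero fun a _ => by rw [iteratedFDeriv_apply_eq_zero_of_notMem_tsupport hXt, smul_zero]

/-- **`lieLaplacian` PRESERVES COMPACT SUPPORT.** [cite: HarishChandra1957DiffOps, §2] -/
theorem hasCompactSupport_lieLaplacian {f : Matrix (Fin 3) (Fin 3) ℂ → E} (hfc : HasCompactSupport f) : HasCompactSupport (lieLaplacian f) :=
  HasCompactSupport.of_support_subset_isCompact hfc ((subset_tsupport _).trans (tsupport_lieLaplacian_subset f))

/-- **`lieCubic` PRESERVES `C^∞`.** [cite: HarishChandra1957DiffOps, §2] -/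
theorem contDiff_lieCubic {f : Matrix (Fin 3) (Fin 3) ℂ → E} (hf : ContDiff ℝ ∞ f) : ContDiff ℝ ∞ (lieCubic f) := by
  have h : lieCubic f = fun X => ∑ a : Fin 9, ∑ b : Fin 9, ∑ c : Fin 9,
      (lieWeight a * lieWeight b * lieWeight c * cubicForm (lieBasis a) (lieBasis b) (lieBasis c)) • iteratedFDeriv ℝ 3 f X ![lieBasis a, lieBasis b, lieBasis c] :=
    funext fun X => lieCubic_def f X
  rw [h]
  exact ContDiff.sum fun a _ => ContDiff.sum fun b _ => ContDiff.sum fun c _ => (contDiff_iteratedFDeriv_apply_const hf 3 _).const_smul _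

/-- `tsupport (lieCubic f) ⊆ tsupport f`. [cite: HarishChandra1957DiffOps, §2] -/
theorem tsupport_lieCubic_subset (f : Matrix (Fin 3) (Fin 3) ℂ → E) : tsupport (lieCubic f) ⊆ tsupport f := by
  refine closure_minimal (fun X hX => ?_) (isClosed_tsupport f)
  by_contra hXt
  refine hX ?_
  rw [lieCubic_def]
  exact Finset.sum_eq_zero fun a _ => Finset.sum_eq_zero fun b _ => Finset.sum_eq_zero fun c _ => by
    rw [iteratedFDeriv_apply_eq_zero_of_notMem_tsupport hXt, smul_zero]

/-- **`lieCubic` PRESERVES COMPACT SUPPORT.** [cite: HarishChandra1957DiffOps, §2] -/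
theorem hasCompactSupport_lieCubic {f : Matrix (Fin 3) (Fin 3) ℂ → E} (hfc : HasCompactSupport f) : HasCompactSupport (lieCubic f) :=
  HasCompactSupport.of_support_subset_isCompact hfc ((subset_tsupport _).trans (tsupport_lieCubic_subset f))

omit [NormedSpace ℝ E] in
/-- `tsupport (r • f) ⊆ tsupport f` and `tsupport (-f) = tsupport f` (scalars and signs do not enlarge the support). [cite: HarishChandra1957DiffOps, §2] -/
theorem tsupport_const_smul_subset [NormedSpace ℝ E] (r : ℝ) (f : Matrix (Fin 3) (Fin 3) ℂ → E) : tsupport (r • f) ⊆ tsupport f :=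
  closure_mono (support_const_smul_subset r f)

omit [NormedSpace ℝ E] in
/-- THE SUPPORT RADIUS IS INHERITED: if `f` is carried by the closed ball `‖X‖ ≤ R` (`f X ≠ 0 → ‖X‖ ≤ R`) and `tsupport g ⊆ tsupport f`, then so is `g`. [cite: HarishChandra1957DiffOps, §2] -/
theorem norm_le_of_ne_zero_of_tsupport_subset {F : Type*} [NormedAddCommGroup F] {f : Matrix (Fin 3) (Fin 3) ℂ → E} {g : Matrix (Fin 3) (Fin 3) ℂ → F} {R : ℝ}
    (hfR : ∀ X, f X ≠ 0 → ‖X‖ ≤ R) (hg : tsupport g ⊆ tsupport f) (X : Matrix (Fin 3) (Fin 3) ℂ) (hX : g X ≠ 0) : ‖X‖ ≤ R := by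
  have hclosed : IsClosed {Y : Matrix (Fin 3) (Fin 3) ℂ | ‖Y‖ ≤ R} := isClosed_le continuous_norm continuous_const
  have hsub : tsupport f ⊆ {Y : Matrix (Fin 3) (Fin 3) ℂ | ‖Y‖ ≤ R} := closure_minimal (fun Y hY => hfR Y hY) hclosed
  exact hsub (hg (subset_tsupport _ hX))

end Closure

/-! ## §2 Linearity of `h ↦ lieOrbital μ h (torusH θ)` and `h ↦ liePhi μ h θ` at a regular `θ` -/

section Linearity

omit [NormedSpace ℝ E] in
/-- At a regular `θ` the integrand `g ↦ h(Ad_g torusH θ)` of a continuous compactly supported `h` has compact support. [cite: WarnerHASSLG2, §8.4.1] -/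
theorem hasCompactSupport_apply_conj_torusH {h : Matrix (Fin 3) (Fin 3) ℂ → E} (hhc : HasCompactSupport h) (θ : Fin 3 → ℝ) (h02 : θ 0 ≠ θ 2)
    (h12 : θ 1 ≠ θ 2) : HasCompactSupport fun g : U21 => h (mat g * torusH θ * mat g⁻¹) :=
  HasCompactSupport.of_support_subset_isCompact (isCompact_setOf_conj_torusH_mem_tsupport hhc θ h02 h12)
    fun _ hg => subset_tsupport _ (mem_support.2 (mem_support.1 hg))

omit [NormedSpace ℝ E] in
/-- At a regular `θ` the integrand `g ↦ h(Ad_g torusH θ)` (`h` continuous, compactly supported) is integrable for every `μ` finite on compacta. [cite: WarnerHASSLG2, §8.4.1] -/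
theorem integrable_apply_conj_torusH (μ : Measure U21) [IsFiniteMeasureOnCompacts μ] {h : Matrix (Fin 3) (Fin 3) ℂ → E} (hh : Continuous h) (hhc : HasCompactSupport h)
    (θ : Fin 3 → ℝ) (h02 : θ 0 ≠ θ 2) (h12 : θ 1 ≠ θ 2) : Integrable (fun g : U21 => h (mat g * torusH θ * mat g⁻¹)) μ :=
  (hh.comp ((continuous_mat.mul continuous_const).mul (continuous_mat.comp continuous_inv))).integrable_of_hasCompactSupport
    (hasCompactSupport_apply_conj_torusH hhc θ h02 h12)

/-- **ADDITIVITY of `h ↦ lieOrbital μ h (torusH θ)`** at a regular `θ`. [cite: WarnerHASSLG2, §8.4.1] -/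
theorem lieOrbital_add_torusH (μ : Measure U21) [IsFiniteMeasureOnCompacts μ] {h₁ h₂ : Matrix (Fin 3) (Fin 3) ℂ → E} (hh₁ : Continuous h₁) (hh₁c : HasCompactSupport h₁)
    (hh₂ : Continuous h₂) (hh₂c : HasCompactSupport h₂) (θ : Fin 3 → ℝ) (h02 : θ 0 ≠ θ 2) (h12 : θ 1 ≠ θ 2) :
    lieOrbital μ (h₁ + h₂) (torusH θ) = lieOrbital μ h₁ (torusH θ) + lieOrbital μ h₂ (torusH θ) := by
  simp only [lieOrbital_def, Pi.add_apply]
  exact integral_add (integrable_apply_conj_torusH μ hh₁ hh₁c θ h02 h12) (integrable_apply_conj_torusH μ hh₂ hh₂c θ h02 h12)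

/-- **HOMOGENEITY of `h ↦ lieOrbital μ h X`** (no hypothesis). [cite: WarnerHASSLG2, §8.4.1] -/
theorem lieOrbital_const_smul (μ : Measure U21) (r : ℝ) (h : Matrix (Fin 3) (Fin 3) ℂ → E) (X : Matrix (Fin 3) (Fin 3) ℂ) :
    lieOrbital μ (r • h) X = r • lieOrbital μ h X := by
  simp only [lieOrbital_def, Pi.smul_apply]
  exact integral_smul r _

/-- `lieOrbital μ (-h) X = -lieOrbital μ h X` (no hypothesis). [cite: WarnerHASSLG2, §8.4.1] -/
theorem lieOrbital_neg (μ : Measure U21) (h : Matrix (Fin 3) (Fin 3) ℂ → E) (X : Matrix (Fin 3) (Fin 3) ℂ) : lieOrbital μ (-h) X = -lieOrbital μ h X := by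
  simp only [lieOrbital_def, Pi.neg_apply]
  exact integral_neg _

/-- **ADDITIVITY of `h ↦ liePhi μ h θ`** at a regular `θ`. [cite: WarnerHASSLG2, §8.4.1] -/
theorem liePhi_add (μ : Measure U21) [IsFiniteMeasureOnCompacts μ] {h₁ h₂ : Matrix (Fin 3) (Fin 3) ℂ → E} (hh₁ : Continuous h₁) (hh₁c : HasCompactSupport h₁)
    (hh₂ : Continuous h₂) (hh₂c : HasCompactSupport h₂) (θ : Fin 3 → ℝ) (h02 : θ 0 ≠ θ 2) (h12 : θ 1 ≠ θ 2) :
    liePhi μ (h₁ + h₂) θ = liePhi μ h₁ θ + liePhi μ h₂ θ := by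
  rw [liePhi_def, liePhi_def, liePhi_def, lieOrbital_add_torusH μ hh₁ hh₁c hh₂ hh₂c θ h02 h12, smul_add]

/-- **HOMOGENEITY of `h ↦ liePhi μ h θ`** (no hypothesis). [cite: WarnerHASSLG2, §8.4.1] -/
theorem liePhi_const_smul (μ : Measure U21) (r : ℝ) (h : Matrix (Fin 3) (Fin 3) ℂ → E) (θ : Fin 3 → ℝ) : liePhi μ (r • h) θ = r • liePhi μ h θ := by
  rw [liePhi_def, liePhi_def, lieOrbital_const_smul, smul_comm]

/-- `liePhi μ (-h) θ = -liePhi μ h θ` (no hypothesis). [cite: WarnerHASSLG2, §8.4.1] -/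
theorem liePhi_neg (μ : Measure U21) (h : Matrix (Fin 3) (Fin 3) ℂ → E) (θ : Fin 3 → ℝ) : liePhi μ (-h) θ = -liePhi μ h θ := by
  rw [liePhi_def, liePhi_def, lieOrbital_neg, smul_neg]

/-- As FUNCTIONS of `θ`: `liePhi μ (r • h) = r • liePhi μ h`. [cite: WarnerHASSLG2, §8.4.1] -/
theorem liePhi_const_smul_fun (μ : Measure U21) (r : ℝ) (h : Matrix (Fin 3) (Fin 3) ℂ → E) : liePhi μ (r • h) = r • liePhi μ h :=
  funext fun θ => by rw [liePhi_const_smul, Pi.smul_apply]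

/-- As FUNCTIONS on the regular set: `liePhi μ (h₁ + h₂) = liePhi μ h₁ + liePhi μ h₂` on `{rootProduct ≠ 0}`. [cite: WarnerHASSLG2, §8.4.1] -/
theorem liePhi_add_eqOn (μ : Measure U21) [IsFiniteMeasureOnCompacts μ] {h₁ h₂ : Matrix (Fin 3) (Fin 3) ℂ → E} (hh₁ : Continuous h₁) (hh₁c : HasCompactSupport h₁)
    (hh₂ : Continuous h₂) (hh₂c : HasCompactSupport h₂) :
    EqOn (liePhi μ (h₁ + h₂)) (liePhi μ h₁ + liePhi μ h₂) {θ : Fin 3 → ℝ | rootProduct θ ≠ 0} := fun θ hθ => by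
  rw [Pi.add_apply]
  exact liePhi_add μ hh₁ hh₁c hh₂ hh₂c θ (sub_ne_zero.1 (sub_ne_zero_of_rootProduct_ne_zero hθ).2.1) (sub_ne_zero.1 (sub_ne_zero_of_rootProduct_ne_zero hθ).2.2)

end Linearity

/-! ## §3 Smoothness of `liePhi μ f` on the regular set -/

section Regular

/-- The regular set `{rootProduct ≠ 0}` is open. [cite: WarnerHASSLG2, §8.4.1] -/
theorem isOpen_setOf_rootProduct_ne_zero : IsOpen {θ : Fin 3 → ℝ | rootProduct θ ≠ 0} :=
  isOpen_ne_fun contDiff_rootProduct.continuous continuous_const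

/-- The larger set off the two SINGULAR walls `{θ₀ ≠ θ₂} ∩ {θ₁ ≠ θ₂}` is open. [cite: WarnerHASSLG2, §8.4.1] -/
theorem isOpen_setOf_ne_two : IsOpen {θ : Fin 3 → ℝ | θ 0 ≠ θ 2 ∧ θ 1 ≠ θ 2} :=
  (isOpen_ne_fun (continuous_apply 0) (continuous_apply 2)).inter (isOpen_ne_fun (continuous_apply 1) (continuous_apply 2))

/-- The regular set lies off the singular walls. [cite: WarnerHASSLG2, §8.4.1] -/
theorem setOf_rootProduct_ne_zero_subset : {θ : Fin 3 → ℝ | rootProduct θ ≠ 0} ⊆ {θ : Fin 3 → ℝ | θ 0 ≠ θ 2 ∧ θ 1 ≠ θ 2} := fun _ hθ =>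
  ⟨sub_ne_zero.1 (sub_ne_zero_of_rootProduct_ne_zero hθ).2.1, sub_ne_zero.1 (sub_ne_zero_of_rootProduct_ne_zero hθ).2.2⟩

variable [CompleteSpace E]

/-- **`liePhi μ f` IS `C^∞` AT EVERY POINT OFF THE SINGULAR WALLS** (`f ∈ C_c^∞`, `μ` finite on compacta): `π` is a polynomial and `Φ_f` is smooth there by ★ (a1). [cite: WarnerHASSLG2, §8.4.1] -/
theorem contDiffAt_liePhi (μ : Measure U21) [IsFiniteMeasureOnCompacts μ] {f : Matrix (Fin 3) (Fin 3) ℂ → E} (hf : ContDiff ℝ ∞ f) (hfc : HasCompactSupport f)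
    (θ : Fin 3 → ℝ) (h02 : θ 0 ≠ θ 2) (h12 : θ 1 ≠ θ 2) : ContDiffAt ℝ ∞ (liePhi μ f) θ := by
  rw [liePhi_eq_smul_fun μ f]
  exact contDiff_rootProduct.contDiffAt.smul (contDiffAt_lieOrbital_torusH μ hf hfc θ h02 h12)

/-- **`liePhi μ f` IS `C^∞` ON THE OPEN SET OFF THE SINGULAR WALLS.** [cite: WarnerHASSLG2, §8.4.1] -/
theorem contDiffOn_liePhi_ne_two (μ : Measure U21) [IsFiniteMeasureOnCompacts μ] {f : Matrix (Fin 3) (Fin 3) ℂ → E} (hf : ContDiff ℝ ∞ f) (hfc : HasCompactSupport f) :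
    ContDiffOn ℝ ∞ (liePhi μ f) {θ : Fin 3 → ℝ | θ 0 ≠ θ 2 ∧ θ 1 ≠ θ 2} := fun θ hθ =>
  (contDiffAt_liePhi μ hf hfc θ hθ.1 hθ.2).contDiffWithinAt

/-- **`liePhi μ f` IS `C^∞` ON THE REGULAR SET `{rootProduct ≠ 0}`** — the locality domain of the holonomic system (E1)(E2)(E3). [cite: WarnerHASSLG2, §8.4.1, §8.4.3] -/
theorem contDiffOn_liePhi (μ : Measure U21) [IsFiniteMeasureOnCompacts μ] {f : Matrix (Fin 3) (Fin 3) ℂ → E} (hf : ContDiff ℝ ∞ f) (hfc : HasCompactSupport f) :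
    ContDiffOn ℝ ∞ (liePhi μ f) {θ : Fin 3 → ℝ | rootProduct θ ≠ 0} :=
  (contDiffOn_liePhi_ne_two μ hf hfc).mono setOf_rootProduct_ne_zero_subset

end Regular

end BallModel

end Literature.Geometry.ComplexHyperbolic

/-! ## §4 The sup-norm basis bound for continuous multilinear maps on `(ι → ℝ)ⁿ` (generic) -/

namespace Literature.Analysis.Calculus

open _root_.Finset

variable {ι : Type*} [Fintype ι] [DecidableEq ι] {E : Type*} [NormedAddCommGroup E] [NormedSpace ℝ E]

/-- Expansion of a multilinear map on `(ι → ℝ)ⁿ` along the coordinate vectors: `A(v) = Σ_{k : Fin n → ι} (Π_j v_j(k_j)) • A(e_{k₁}, …, e_{kₙ})`. [cite: Rudin1976, Thm. 9.21] -/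
theorem continuousMultilinearMap_apply_eq_sum_prod_smul {n : ℕ} (A : ContinuousMultilinearMap ℝ (fun _ : Fin n => ι → ℝ) E) (v : Fin n → ι → ℝ) :
    A v = ∑ k : Fin n → ι, (∏ j, v j (k j)) • A (fun j => Pi.single (k j) (1 : ℝ)) := by
  have hv : v = fun j => ∑ i : ι, v j i • (Pi.single i (1 : ℝ) : ι → ℝ) := by
    funext j
    conv_lhs => rw [← Finset.univ_sum_single (v j)]
    refine Finset.sum_congr rfl fun i _ => ?_
    funext l
    by_cases h : l = i
    · subst h; simp
    · simp [h]
  conv_lhs => rw [hv]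
  rw [A.map_sum (fun j i => v j i • (Pi.single i (1 : ℝ) : ι → ℝ))]
  refine Finset.sum_congr rfl fun k _ => ?_
  exact A.map_smul_univ (fun j => v j (k j)) (fun j => (Pi.single (k j) (1 : ℝ) : ι → ℝ))

/-- **THE SUP-NORM BASIS BOUND**: `‖A‖ ≤ Σ_{k : Fin n → ι} ‖A(e_{k₁}, …, e_{kₙ})‖` for a continuous multilinear map on `(ι → ℝ)ⁿ` with the sup norm — a jet is controlled by its pure
coordinate partials. [cite: Rudin1976, Thm. 9.21] -/
theorem continuousMultilinearMap_opNorm_le_sum_apply_single {n : ℕ} (A : ContinuousMultilinearMap ℝ (fun _ : Fin n => ι → ℝ) E) :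
    ‖A‖ ≤ ∑ k : Fin n → ι, ‖A (fun j => Pi.single (k j) (1 : ℝ))‖ := by
  refine A.opNorm_le_bound (by positivity) (fun v => ?_)
  rw [continuousMultilinearMap_apply_eq_sum_prod_smul A v, Finset.sum_mul]
  refine (norm_sum_le _ _).trans (Finset.sum_le_sum fun k _ => ?_)
  rw [norm_smul, mul_comm]
  refine mul_le_mul_of_nonneg_left ?_ (norm_nonneg _)
  rw [norm_prod]
  exact Finset.prod_le_prod (fun j _ => norm_nonneg _) fun j _ => norm_le_pi_norm (v j) (k j)

/-- The jet form: `‖Dⁿφ(x)‖ ≤ Σ_{k : Fin n → ι} ‖Dⁿφ(x)(e_{k₁}, …, e_{kₙ})‖`. [cite: Rudin1976, Thm. 9.21] -/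
theorem norm_iteratedFDeriv_le_sum_apply_single {n : ℕ} (φ : (ι → ℝ) → E) (x : ι → ℝ) :
    ‖iteratedFDeriv ℝ n φ x‖ ≤ ∑ k : Fin n → ι, ‖iteratedFDeriv ℝ n φ x (fun j => Pi.single (k j) (1 : ℝ))‖ :=
  continuousMultilinearMap_opNorm_le_sum_apply_single _

end Literature.Analysis.Calculus

end
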